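import Literature.Probability.LatticeModels.GlauberUniformGapFatRectangles
import Literature.Probability.LatticeModels.GlauberDynamicsLogSobolevBounds
import HarnessLib

/-!
# [Mar99] Theorem 4.6, the base scale: a log-Sobolev inequality uniform on `𝓡_L` (fixed `L`), PROVED

Topic `Literature/Probability/LatticeModels`; cell `ym-ir`, seat lit-3 (census rows B2/B4).  Theorems only
(D-0026).  [Mar99] F. Martinelli, LNM 1717 (1999): the «trivial estimate on `inf_σ μ_Λ^τ(σ)`» of Proposition
3.9 (p0179 L10–15, `μ_Λ^τ(σ) ≥ 2^{−|Λ|} e^{−2‖βH_Λ‖_∞}`) for the finite-range Gibbs kernels `U.spec β`, and its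
consequence used at the smallest scale of the recursion of Theorem 4.6 (p0191 L27 – p0192 L1, «using (4.25)
and Proposition 3.9»): at every FIXED scale `L`, all the Gibbs measures `μ_R^τ`, `R ∈ 𝓡_L`, `τ` arbitrary,
satisfy a log-Sobolev inequality with one constant (Theorem 4.5's uniform gap `fatRectangles_uniform_gap` +
Proposition 3.9 `Martinelli1999_prop3_9` + the atom bound).  Contents:
* `Glauber.abs_hamiltonianIn_le_pow` — `|H_Λ(σ)| ≤ C 2^{n(2r+1)^d}` for `|Λ| ≤ n` (`C` a bound on the
  interaction terms);
* `Glauber.spec_real_singleton_ge` — the atom bound `μ_Λ^τ(σ) ≥ e^{−2|β|C 2^{n(2r+1)^d}} 2^{−n}` for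
  `μ_Λ^τ`-a.e. `σ`, `|Λ| ≤ n`;
* `Glauber.fatRectangles_logSobolev_at_scale` — for every `L` there is `c` with `c_s(μ_R^τ) ≤ c` for all
  `R ∈ 𝓡_L` and all `τ` (under `SMT` on all fat rectangles, through Theorem 4.5).
SIBLING-SETTING result (`±1` spins, range `r`); the Yang–Mills gap is not touched.
[cite: Martinelli1999, Proposition 3.9; Theorem 4.6, proof]
-/

open MeasureTheory ProbabilityTheory Finset Filter

open scoped ENNReal

noncomputable section

namespace Literature.Probability.LatticeModels

namespace Glauber

section Atoms

variable {d r : ℕ} (U : FRPotential d ℤˣ r) (β : ℝ)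

/-- **The finite-volume Hamiltonian is bounded through the volume**: `|H_Λ(σ)| ≤ C · 2^{n(2r+1)^d}` whenever
`|Λ| ≤ n` and `|U_X| ≤ C` for all `X` (the interaction sets meeting `Λ` are subsets of the `r`-neighbourhood of
`Λ`, which has at most `|Λ|(2r+1)^d` sites). [cite: Martinelli1999, Proposition 3.9, proof] -/
theorem abs_hamiltonianIn_le_pow {C : ℝ} (hC0 : 0 ≤ C) (hC : ∀ (X : Finset (Site d)) (σ : Site d → ℤˣ), |U.U X σ| ≤ C)
    {Λ : Finset (Site d)} {n : ℕ} (hn : Λ.card ≤ n) (σ : Site d → ℤˣ) :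
    |hamiltonianIn U.U (interactionSets r) Λ σ| ≤ C * 2 ^ (n * (2 * r + 1) ^ d) := by
  classical
  have h1 := abs_hamiltonianIn_le (Φ := U.U) (C := fun _ => C) (fun A σ => hC A σ) (interactionSets r) Λ σ
  refine h1.trans ?_
  rw [Finset.sum_const, nsmul_eq_mul, mul_comm]
  refine mul_le_mul_of_nonneg_left ?_ hC0
  have h2 : ((interactionSets r Λ).filter fun A => (A ∩ Λ).Nonempty).card ≤ (interactionSets r Λ).card :=
    Finset.card_filter_le _ _
  have h3 : (interactionSets r Λ).card ≤ ((Λ.biUnion fun y => rNeighbourhood r y).powerset).card := by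
    unfold interactionSets; exact Finset.card_filter_le _ _
  rw [Finset.card_powerset] at h3
  have h4 : (Λ.biUnion fun y => rNeighbourhood r y).card ≤ n * (2 * r + 1) ^ d := by
    refine Finset.card_biUnion_le.trans ?_
    rw [Finset.sum_const_nat (m := (2 * r + 1) ^ d) fun y _ => card_rNeighbourhood r y]
    exact Nat.mul_le_mul_right _ hn
  have h5 : 2 ^ (Λ.biUnion fun y => rNeighbourhood r y).card ≤ 2 ^ (n * (2 * r + 1) ^ d) :=
    Nat.pow_le_pow_right (by norm_num) h4
  exact_mod_cast h2.trans (h3.trans h5)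

/-- The a priori measure `count^{⊗Λ}` on `(ℤˣ)^Λ` has total mass `2^{|Λ|}`. [folklore] -/
private theorem pi_count_univ (Λ : Finset (Site d)) :
    (Measure.pi fun _ : ↥Λ => (Measure.count : Measure ℤˣ)) Set.univ = 2 ^ Λ.card := by
  rw [Measure.pi_univ]
  simp only [Measure.count_univ, ENat.card_eq_coe_fintype_card, Fintype.card_units_int, Finset.prod_const,
    Finset.card_univ, Fintype.card_coe]
  norm_cast

set_option maxHeartbeats 800000 in
/-- **The trivial atom bound** ([Mar99] Proposition 3.9, proof, p0179 L14–15: «a trivial estimate on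
`inf_σ μ_Λ^τ(σ)`»): for `μ_Λ^τ`-almost every `σ` (those agreeing with `τ` off `Λ`),
`μ_Λ^τ(σ) ≥ e^{−2|β| C 2^{n(2r+1)^d}} 2^{−n}` whenever `|Λ| ≤ n`, `|U_X| ≤ C`.
[cite: Martinelli1999, Proposition 3.9, proof] -/
theorem spec_real_singleton_ge {C : ℝ} (hC0 : 0 ≤ C) (hC : ∀ (X : Finset (Site d)) (σ : Site d → ℤˣ), |U.U X σ| ≤ C)
    {Λ : Finset (Site d)} {n : ℕ} (hn : Λ.card ≤ n) (τ : Site d → ℤˣ) :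
    ∀ᵐ σ ∂(U.spec β Λ τ),
      Real.exp (-(2 * (|β| * (C * 2 ^ (n * (2 * r + 1) ^ d))))) * ((2 : ℝ) ^ n)⁻¹ ≤ (U.spec β Λ τ).real {σ} := by
  classical
  have hγ := U.isSpecification_spec β
  haveI := hγ.isProbability Λ τ
  set H := hamiltonianIn U.U (interactionSets r) Λ with hH
  set φ : (Site d → ℤˣ) → ℝ := fun σ => -β * H σ with hφ
  set π : Measure (Site d → ℤˣ) :=
    (Measure.pi fun _ : ↥Λ => (Measure.count : Measure ℤˣ)).map (glueWith Λ · τ) with hπ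
  have hμ : U.spec β Λ τ = π.tilted φ := rfl
  set Cφ : ℝ := |β| * (C * 2 ^ (n * (2 * r + 1) ^ d)) with hCφ
  have hφb : ∀ σ, |φ σ| ≤ Cφ := fun σ => by
    simp only [hφ]
    rw [abs_mul, abs_neg]
    exact mul_le_mul_of_nonneg_left (abs_hamiltonianIn_le_pow U hC0 hC hn σ) (abs_nonneg β)
  have hφm : Measurable φ := (measurable_hamiltonianIn (fun A => (U.adapted A).2) _ Λ).const_mul _
  haveI : NeZero π := ⟨map_glueWith_pi_ne_zero Measure.count (NeZero.ne _) Λ τ⟩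
  haveI : IsFiniteMeasure π := by rw [hπ]; infer_instance
  -- total mass of the reference measure
  have hπuniv : π Set.univ = 2 ^ Λ.card := by
    rw [hπ, Measure.map_apply (measurable_glueWith Λ τ) MeasurableSet.univ, Set.preimage_univ]
    exact pi_count_univ Λ
  have hπreal : π.real Set.univ = 2 ^ Λ.card := by
    rw [measureReal_def, hπuniv]; simp
  -- the normaliser
  have hint := integrable_exp_map_glueWith_pi (Measure.count : Measure ℤˣ) Λ τ hφm ⟨Cφ, hφb⟩
  have hZle : ∫ x, Real.exp (φ x) ∂π ≤ Real.exp Cφ * 2 ^ Λ.card := by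
    calc ∫ x, Real.exp (φ x) ∂π ≤ ∫ x, Real.exp Cφ ∂π :=
          integral_mono hint (integrable_const _) fun x => Real.exp_le_exp.2 ((le_abs_self _).trans (hφb x))
      _ = π.real Set.univ * Real.exp Cφ := by rw [integral_const, smul_eq_mul]
      _ = Real.exp Cφ * 2 ^ Λ.card := by rw [hπreal, mul_comm]
  have hZle' : ∫ x, Real.exp (φ x) ∂π ≤ Real.exp Cφ * 2 ^ n :=
    hZle.trans (mul_le_mul_of_nonneg_left (pow_le_pow_right₀ one_le_two hn) (Real.exp_pos _).le)
  have hZpos : 0 < ∫ x, Real.exp (φ x) ∂π := integral_exp_pos hint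
  filter_upwards [hγ.proper Λ τ] with σ hσ
  -- the glued preimage of `σ`
  set ζ₀ : ↥Λ → ℤˣ := fun x => σ x with hζ₀
  have hglue : glueWith Λ ζ₀ τ = σ := by
    funext x
    by_cases hx : x ∈ Λ
    · rw [glueWith_apply_mem Λ ζ₀ τ hx]
    · rw [glueWith_apply_not_mem Λ ζ₀ τ hx, hσ x hx]
  have hπσ : 1 ≤ π {σ} := by
    rw [hπ, Measure.map_apply (measurable_glueWith Λ τ) (measurableSet_singleton σ)]
    have hsub : ({ζ₀} : Set (↥Λ → ℤˣ)) ⊆ (glueWith Λ · τ) ⁻¹' {σ} := by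
      intro ζ hζ
      rw [Set.mem_singleton_iff] at hζ
      rw [Set.mem_preimage, hζ, hglue, Set.mem_singleton_iff]
    calc (1 : ℝ≥0∞) = Measure.pi (fun _ : ↥Λ => (Measure.count : Measure ℤˣ)) {ζ₀} := by
          rw [Measure.pi_singleton]; simp
      _ ≤ _ := measure_mono hsub
  -- the atom
  have hμσ : U.spec β Λ τ {σ} = ENNReal.ofReal (Real.exp (φ σ) / ∫ x, Real.exp (φ x) ∂π) * π {σ} := by
    rw [hμ, tilted_apply' _ _ (measurableSet_singleton σ), lintegral_singleton]
  have hreal : Real.exp (-(2 * Cφ)) * ((2 : ℝ) ^ n)⁻¹ ≤ Real.exp (φ σ) / ∫ x, Real.exp (φ x) ∂π := by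
    have e : Real.exp (-(2 * Cφ)) * ((2 : ℝ) ^ n)⁻¹ = Real.exp (-Cφ) / (Real.exp Cφ * 2 ^ n) := by
      rw [eq_div_iff (by positivity), show -(2 * Cφ) = -Cφ + -Cφ by ring, Real.exp_add, Real.exp_neg Cφ]
      field_simp
    rw [e]
    exact div_le_div₀ (Real.exp_pos _).le (Real.exp_le_exp.2 ((neg_abs_le _).trans' (neg_le_neg (hφb σ))))
      hZpos hZle'
  have hlow : ENNReal.ofReal (Real.exp (-(2 * Cφ)) * ((2 : ℝ) ^ n)⁻¹) ≤ U.spec β Λ τ {σ} := by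
    rw [hμσ]
    calc ENNReal.ofReal (Real.exp (-(2 * Cφ)) * ((2 : ℝ) ^ n)⁻¹)
        ≤ ENNReal.ofReal (Real.exp (φ σ) / ∫ x, Real.exp (φ x) ∂π) := ENNReal.ofReal_le_ofReal hreal
      _ = ENNReal.ofReal (Real.exp (φ σ) / ∫ x, Real.exp (φ x) ∂π) * 1 := (mul_one _).symm
      _ ≤ _ := mul_le_mul' le_rfl hπσ
  rw [measureReal_def]
  exact (ENNReal.ofReal_le_iff_le_toReal (measure_ne_top _ _)).1 hlow

end Atoms

section Base

variable {r : ℕ} (U : FRPotential 2 ℤˣ r) (β : ℝ)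

set_option maxHeartbeats 800000 in
/-- **[Mar99] Theorem 4.6 at a fixed scale** (p0191 L27 – p0192 L1 with Proposition 3.9): under `SMT` on all
fat rectangles, for every `L` there is one constant `c ≥ 0` with `c_s(μ_R^τ) ≤ c` for all `R ∈ 𝓡_L` and all
boundary conditions `τ` — Theorem 4.5's uniform gap, the atom bound `spec_real_singleton_ge` (`|R| ≤ L²`) and
Proposition 3.9. [cite: Martinelli1999, Theorem 4.6, proof; Proposition 3.9] -/
theorem fatRectangles_logSobolev_at_scale {lS : ℕ} {m : ℝ} (hm : 0 < m)
    (hSMT : ∀ L : ℕ, ∀ Q ∈ fatRectangles L, SMT (U.spec β) Q lS m) (L : ℕ) :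
    ∃ c : ℝ, 0 ≤ c ∧ ∀ R ∈ fatRectangles L, ∀ τ : Site 2 → ℤˣ, LogSobolevIneq (U.spec β R τ) R c := by
  classical
  obtain ⟨g, hg, hgap⟩ := fatRectangles_uniform_gap U β hm hSMT
  obtain ⟨C, hC0, hC⟩ := U.exists_uniform_bound
  have hγ := U.isSpecification_spec β
  set μ₀ : ℝ := Real.exp (-(2 * (|β| * (C * 2 ^ (L * L * (2 * r + 1) ^ 2))))) * ((2 : ℝ) ^ (L * L))⁻¹ with hμ₀
  have hμ₀pos : 0 < μ₀ := by positivity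
  have hK : 0 ≤ 4 + 2 * Real.log μ₀⁻¹ := by
    have h1 : μ₀ ≤ 1 := by
      rw [hμ₀]
      have h2 : Real.exp (-(2 * (|β| * (C * 2 ^ (L * L * (2 * r + 1) ^ 2))))) ≤ 1 :=
        Real.exp_le_one_iff.2 (by rw [neg_nonpos]; positivity)
      have h3 : ((2 : ℝ) ^ (L * L))⁻¹ ≤ 1 := inv_le_one_of_one_le₀ (one_le_pow₀ one_le_two)
      exact mul_le_one₀ h2 (by positivity) h3
    have : 0 ≤ Real.log μ₀⁻¹ := Real.log_nonneg (one_le_inv_iff₀.2 ⟨hμ₀pos, h1⟩)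
    linarith
  refine ⟨(4 + 2 * Real.log μ₀⁻¹) / g, div_nonneg hK hg.le, fun R hR τ => ?_⟩
  haveI := hγ.isProbability R τ
  have hcard : R.card ≤ L * L := by
    obtain ⟨a, b, rfl, hpos, -, hle⟩ := exists_IcoBox_of_mem_fatRectangles hR
    rw [card_IcoBox, Fin.prod_univ_two]
    have h0 : (b 0 - a 0).toNat ≤ L := by have := hle 0; omega
    have h1 : (b 1 - a 1).toNat ≤ L := by have := hle 1; omega
    exact Nat.mul_le_mul h0 h1
  have hatom := spec_real_singleton_ge U β hC0 hC hcard τ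
  exact Martinelli1999_prop3_9 (U.spec β R τ) R hμ₀pos hatom hg (hgap L R hR τ)

end Base

end Glauber

end Literature.Probability.LatticeModels

end
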